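import Literature.RepresentationTheory.CentralSimpleRepresentations
import Literature.NumberTheory.GaloisRepresentations.PicardCurveGaloisRep
import HarnessLib

/-!
# The `Alt(B)`-module `(𝔽_p^B)^00` is central simple (Zarhin 2023, Theorem 4.7 (iii), (iv); Zarhin 2002, Lemma 2.6 at `(n, p) = (5, 5)`)

Topic `Literature/RepresentationTheory`, namespace `Literature.RepresentationTheory`; lane `lit-hodgefound`
(Track 2 foundations library), row g12-#1 of seat p11 (gen 12), FILE 2 of 2: the application of FILE 1
(`CentralSimpleRepresentations.lean`: Zarhin 2023 §4, Definition 4.1 – Corollary 4.6) to the heart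
`(k^B)^{00}` of a permutation module (`PermutationModuleHeart.lean`, g11-#1: `heart k G X`).
THEOREMS ONLY (no definition, no named fact; net debt 0).

## Sources READ (held texts), verbatim

Yu. G. Zarhin, *Superelliptic jacobians and central simple representations*, arXiv:2305.12022 (bib
`Zarhin2023Superelliptic`; held text `paper:arxiv-2305.12022`), §4. p0019–p0020: "**Theorem 4.7.**
Suppose that `n ≥ 5` is an integer, `B` is an `n`-element set, and `p` is a prime. Let us consider the
vector space `(𝔽_p^B)^{00}` over the field `𝔽_p` endowed with the natural structure of a
`Perm(B)`-module (see Definition 3.2) […] Then: (i) The `Perm(B)`-module `(𝔽_p^B)^{00}` is very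
simple. (ii) The `Alt(B)`-module `(𝔽_p^B)^{00}` is very simple if and only if either `n > 5` or `n = 5`,
`p ≢ ±1 mod 5`. (iii) Suppose that `n = 5`, `p ≡ ±1 mod 5` and `R ⊂ End_{𝔽_p}((𝔽_p^B)^{00})` is a
`Alt(B)`-normal subalgebra. Then either `R = 𝔽_p · Id`, or `R = End_{𝔽_p}((𝔽_p^B)^{00})`, or the
`𝔽_p`-algebra `R` is isomorphic to the matrix algebra `Mat_2(𝔽_p)` of size `2` over `𝔽_p`. (iv) The
`Alt(B)`-module `(𝔽_p^B)^{00}` is central simple. **Remark 4.8.** The assertion of Theorem 4.7 was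
earlier proven in the following cases. (A) `p ∈ {2, 3}` […] (B) `p > 3` and `n ≥ 8` […] (C)
`N = dim_{𝔽_p}((𝔽_p^B)^{00})` is a prime. It follows readily from [36, Cor. 4.4(i)] applied to
`H = Alt(B)` and `V = (𝔽_p^B)^{00}`. (We may apply this result from [36], because `Alt(B)` is a simple
non-abelian group of order `n!/2` and therefore its order is bigger that the order of `S_N`, since
`N ≤ n − 1`.)" p0021–p0022 (proof, end of Step 5): "On the other hand, it follows from Theorem 4.5
that if `R` is a non-obvious `Alt(B)`-normal subalgebra of `End_{𝔽_p}((𝔽_p^B)^0)` then `R ≅ Mat_a(𝔽_p)`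
where a positive integer `a` is a proper divisor of `dim_{𝔽_p}((𝔽_p^B)^0) = 4 = 2²`. This implies that
`a = 2` and `R ≅ Mat_2(𝔽_p)`. The assertion (iv) of Theorem 4.7 follows readily from already proven (ii)
and (iii)."

Yu. G. Zarhin, *Cyclic covers of the projective line, their jacobians and endomorphisms*, J. reine
angew. Math. 544 (2002) 91–110 (bib `Zarhin2002CyclicCovers`; held text `paper:arxiv-math_0008134`),
§2 p0004: "**Example 2.3.** Suppose `n = p = 5` and `G = Alt(B) ≅ A_5`. Then in the notations of
[Atlas], p. 2 and [AtlasB], p. 2 `χ̄_B = 1 + χ_4` and the restriction of `φ̄_B − 1 = χ_4 − 1` to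
`G^{(5)}` coincides with absolutely irreducible Brauer character `φ_2`. This implies that the
`Alt(B)`-module `(𝔽_p^B)^{00}` is absolutely simple. […] **Lemma 2.4.** Assume that `G` acts doubly
transitively on `B`. If `p` does not divide `n` then `End_G((𝔽_p^B)^0) = 𝔽_p`. […] **Remark 2.5.**
Assume that `n = #(B)` is divisible by `p`. Let us choose `b ∈ B` and let `G′ := G_b` be the
stabilizer of `b` in `G` and `B′ = B ∖ {b}`. Then `n′ = #(B′) = n − 1` is not divisible by `p` and there
is a canonical isomorphism of `G′`-modules `(𝔽_p^{B′})^{00} ≅ (𝔽_p^B)^{00}` […] This implies that if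
the `G_b`-module `(𝔽_p^{B′})^{00}` is absolutely simple then the `G`-module `(𝔽_p^B)^{00}` is also
absolutely simple. For example, if `G = Perm(B)` (resp. `Alt(B)`) then `G_b = Perm(B′)` (resp.
`Alt(B′)`) […] The following assertion goes back to Dickson. **Lemma 2.6.** Assume that `G = Perm(B)`
or `Alt(B)`. Then the `G`-module `(𝔽_p^B)^{00}` is absolutely simple. Proof. In light of Example 2.3,
we may assume that `(n, p) ≠ (5, 5)`. In light of Remark 2.5 we may assume that `p` does not
divide `n` […]".

## What is proved (carrier: g11-#1's `heart k G X` on `(k^B)^0/((k^B)^0 ∩ k·1_B)`, any field `k`)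

* §1 central simplicity is monotone in the operators (`IsCentralSimple.of_range_subset`, Remark 4.2
  (ii)/(iv)); §2 the heart depends only on the image of `G` in `Perm(B)` (`heart_eq_of_toPermHom_eq`,
  `range_heart_alternatingGroup_subset`).
* §3 **Lemma 2.6 at `(n, p) = (5, 5)`** — the case `PermutationModuleHeart.lean` left open — for every
  field `k` of characteristic `5`, `#B = 5` and every `G ↠ ⊇ Alt(B)`: the heart is irreducible
  (`heart_isIrreducible_of_card_eq_five`) with commutant `k·Id`
  (`centralizer_heart_eq_bot_of_card_eq_five`). DEVIATION (recorded): Example 2.3 reads this off the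
  Brauer character table of `A_5` ([Atlas]); here it is Remark 2.5 (`#B′ = 4`, `char ≠ 2`) + the
  irreducibility of the `Alt(B′)`-module `(k^{B′})^0` for `#B′ = 4` in characteristic `≠ 2` (the tree's
  `augmentationRep_isIrreducible_of_alternatingGroup_le`, `PicardCurveGaloisRep.lean`) + Lemma 2.4's
  double transitivity (g10-#3's `centralizer_augmentationRep_eq_bot_of_isMultiplyPretransitive`;
  `Alt(B′)` is `2`-transitive on `4` letters, Mathlib `alternatingGroup.isMultiplyPretransitive`).
  Assembled with Q1110 (`char ∤ n`) and g11-#1 (`char ∣ n`, `n ≥ 6`): **the heart is absolutely simple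
  for every `n ≥ 5`, every field and every `G ↠ ⊇ Alt(B)`** (`heart_isIrreducible_of_five_le`,
  `centralizer_heart_eq_bot_of_five_le`).
* §4 **Theorem 4.7 (iv)**: the `Alt(B)`-module `(k^B)^{00}` is CENTRAL SIMPLE for every finite field
  `k` and `n ≥ 5` (`isCentralSimple_heart_alternatingGroup`; `k = 𝔽_p`:
  `isCentralSimple_heart_alternatingGroup_zmod`), hence for every `G ↠ ⊇ Alt(B)`
  (`isCentralSimple_heart_of_alternatingGroup_le`) and for `Perm(B)` (`isCentralSimple_heart_perm`);
  strongly simple (`isStronglySimple_heart_alternatingGroup`). Proof = Theorem 4.5 (e) with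
  `H = G = Alt(B)` (FILE 1's `isCentralSimple_of_factorial_lt`): `Alt(B)` simple, the heart absolutely
  simple (§3), and (i) by Remark 4.8 (C)'s count `N! ≤ (n − 1)! < n!/2 = #Alt(B)`
  (`factorial_finrank_heart_lt_card_alternatingGroup`). DEVIATION (recorded): the print obtains (iv)
  from (ii) and (iii) — i.e. through the very-simplicity theorems, whose cases `p > 3`, `n ∈ {5, 7}`
  and `n ≥ 8` rest on Dickson's list of subgroups of `PSL(2, 𝔽_p)` [29] and the Schur multiplier of
  `A_n` (not in the tree); the route through Theorem 4.5 (e) is uniform in `(n, p)` and is the one the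
  print itself uses for the Mathieu groups (Theorem 4.9, via Proposition 4.4).
* §5 **Theorem 4.7 (iii)**: for `#B = 5` every `Alt(B)`-normal (indeed every `G`-normal,
  `G ↠ ⊇ Alt(B)`) subalgebra of `End_k((k^B)^{00})`, `k` finite, is `k·Id`, `End`, or `≅ Mat_2(k)`
  (`eq_bot_or_eq_top_or_nonempty_algEquiv_matrix_two_of_card_eq_five`; `k = 𝔽_p`, `G = Alt(B)`:
  `zarhin2023_theorem_4_7_iii`): Theorem 4.5 (b) gives `R ≅ Mat_a(k)` with `ab = N ≤ 4`, and `a = 1`,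
  `b = 1` are the two obvious cases. Stated for every prime `p` (the print's `p ≡ ±1 (mod 5)` is the
  case in which the third alternative occurs: Step 5, the `SL(2, 𝔽_5)`-tensor decomposition
  `(𝔽_p^B)^0 ≅ V̄_1 ⊗ V̄_2`, is NOT formalised here; for `p ≢ ±1 (mod 5)` the module is very simple,
  g10-#1's `isVerySimple_augmentationRep_zmod_of_card_eq_five`, and the third case is void).

Not here (recorded): Theorem 4.7 (i) and the remaining cases of (ii) (`n ∈ {5, 7}`, `p > 3`: [29,
Th. 6.25–6.26] = Dickson/Suzuki on subgroups of `PSL(2, 𝔽_p)`), Step 5, Theorem 4.9.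

## References

* [Zarhin2023Superelliptic] Yu. G. Zarhin, *Superelliptic jacobians and central simple
  representations*, arXiv:2305.12022 (2023), §4 Theorem 4.7 (iii), (iv), Remark 4.8 (C), proof Step 5
  (last paragraph), Theorem 4.5 (b), (e), Remark 4.2 (ii), (iv) (held text p0014–p0022).
* [Zarhin2002CyclicCovers] Yu. G. Zarhin, *Cyclic covers of the projective line, their jacobians and
  endomorphisms*, J. reine angew. Math. 544 (2002) 91–110, §2 Example 2.3, Lemma 2.4, Remark 2.5,
  Lemma 2.6 (held text p0004–p0005).
-/

namespace Literature.RepresentationTheory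

open Module MulAction Literature.NumberTheory.GaloisRepresentations

/-! ## §1 Central simplicity is monotone in the set of operators (Remark 4.2 (ii), (iv)) -/

section Transfer

variable {k : Type*} [CommRing k] {G : Type*} [Group G] {V : Type*} [AddCommGroup V] [Module k V]
variable {ρ : Representation k G V}

/-- **Central simplicity is monotone in the set of operators** (Remark 4.2 (ii) and (iv) together: a
`ρ(G)`-normal subalgebra is `ρ'(G')`-normal whenever `ρ'(G') ⊆ ρ(G)`): if `V` is central simple for
`ρ'` and `ρ'(G') ⊆ ρ(G)`, then `V` is central simple for `ρ`.
[cite: Zarhin2023Superelliptic, §4 Remark 4.2 (ii), (iv)] -/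
theorem IsCentralSimple.of_range_subset {G' : Type*} [Group G'] {ρ' : Representation k G' V}
    (h : IsCentralSimple ρ')
    (hsub : Set.range (ρ' : G' → Module.End k V) ⊆ Set.range (ρ : G → Module.End k V)) :
    IsCentralSimple ρ :=
  fun R hR ↦ h R (hR.of_range_subset hsub)

end Transfer

/-! ## §2 The heart depends only on the image of `G` in `Perm(B)` -/

section HeartRange

variable (k : Type*) [Field k] {X : Type*} [Fintype X] [DecidableEq X]
variable {G : Type*} [Group G] [MulAction G X]

omit [Fintype X] [DecidableEq X] in
/-- If `g ∈ G` acts on `X` as the permutation `σ`, then `g` and `σ` act alike on `k^X`. [folklore] -/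
private theorem permRep_eq_of_toPermHom_eq₃ {H : Subgroup (Equiv.Perm X)} {σ : H} {g : G}
    (hg : MulAction.toPermHom G X g = (σ : Equiv.Perm X)) :
    permRep k G X g = permRep k H X σ := by
  refine Finsupp.lhom_ext fun x c ↦ ?_
  rw [permRep_single, permRep_single, Subgroup.smul_def, Equiv.Perm.smul_def, ← hg,
    MulAction.toPermHom_apply, MulAction.toPerm_apply]

omit [Fintype X] [DecidableEq X] in
/-- The same on `(k^X)^0`. [folklore] -/
private theorem augmentationRep_eq_of_toPermHom_eq₃ {H : Subgroup (Equiv.Perm X)} {σ : H} {g : G}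
    (hg : MulAction.toPermHom G X g = (σ : Equiv.Perm X)) :
    augmentationRep k G X g = augmentationRep k H X σ :=
  LinearMap.ext fun w ↦ Subtype.ext (by
    rw [coe_augmentationRep_apply, coe_augmentationRep_apply, permRep_eq_of_toPermHom_eq₃ k hg])

omit [DecidableEq X] in
/-- The same on the heart `(k^X)^{00}`: `g` and `σ` act alike.
[cite: Zarhin2023Superelliptic, §4 Remark 4.2 (ii)] -/
theorem heart_eq_of_toPermHom_eq {H : Subgroup (Equiv.Perm X)} {σ : H} {g : G}
    (hg : MulAction.toPermHom G X g = (σ : Equiv.Perm X)) :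
    heart k G X g = heart k H X σ := by
  refine Submodule.linearMap_qext _ (LinearMap.ext fun u ↦ ?_)
  rw [LinearMap.comp_apply, LinearMap.comp_apply, Submodule.mkQ_apply, heart_apply_mk, heart_apply_mk,
    augmentationRep_eq_of_toPermHom_eq₃ k hg]

/-- **"the `G`-module `V` is […] central simple […] if and only if the corresponding `ρ(G)`-module `V`
is"**, in the form used for `G ↠ ⊇ Alt(B)`: the operators of `Alt(B)` on the heart are among those of
`G`. [cite: Zarhin2023Superelliptic, §4 Remark 4.2 (ii)] -/
theorem range_heart_alternatingGroup_subset (hA : alternatingGroup X ≤ (MulAction.toPermHom G X).range) :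
    Set.range (heart k (alternatingGroup X) X :
        alternatingGroup X → Module.End k (augmentationSubmodule k X ⧸ heartKer k X)) ⊆
      Set.range (heart k G X : G → Module.End k (augmentationSubmodule k X ⧸ heartKer k X)) := by
  rintro _ ⟨σ, rfl⟩
  obtain ⟨g, hg⟩ := hA σ.2
  exact ⟨g, heart_eq_of_toPermHom_eq k hg⟩

/-- The image of `Alt(X)` acting on `X` is `Alt(X)`. [folklore] -/
private theorem alternatingGroup_le_range_toPermHom_self₃ :
    alternatingGroup X ≤ (MulAction.toPermHom (alternatingGroup X) X).range := by
  intro σ hσ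
  refine ⟨⟨σ, hσ⟩, Equiv.ext fun x ↦ ?_⟩
  rfl

end HeartRange

/-! ## §3 Lemma 2.6 at `(n, p) = (5, 5)`: the heart is absolutely simple for every `n ≥ 5` -/

section AbsolutelySimple

variable (k : Type*) [Field k] {X : Type*} [Fintype X] [DecidableEq X]
variable (G : Type*) [Group G] [MulAction G X]

omit [DecidableEq X] in
/-- `#B' = n − 1`, for any `Fintype` structure on `B'`. [folklore] -/
private theorem card_ofStabilizer₃ (b : X) [Fintype (SubMulAction.ofStabilizer G b)] :
    Fintype.card (SubMulAction.ofStabilizer G b) = Fintype.card X - 1 := by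
  rw [Fintype.card_eq_nat_card, SubMulAction.nat_card_ofStabilizer_eq, Nat.card_eq_fintype_card]

omit [Fintype X] [DecidableEq X] [MulAction G X] in
/-- In characteristic `5` (i.e. `5 = 0` in `k`), `2 ≠ 0`. [folklore] -/
private theorem two_ne_zero_of_five_eq_zero (h5 : (5 : k) = 0) : (2 : k) ≠ 0 := fun h2 ↦ by
  have : (1 : k) = 5 - 2 * 2 := by norm_num
  rw [h5, h2, mul_zero, sub_zero] at this
  exact one_ne_zero this

variable {G}

/-- **Lemma 2.6 (Zarhin 2002) at `(n, p) = (5, 5)`, irreducibility** — the instance "through `#B' = 4`"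
left open in `PermutationModuleHeart.lean`: for `#B = 5`, `char(k) = 5` and `G ↠ ⊇ Alt(B)`, the heart
`(k^B)^{00}` (`≅ (k^{B'})^0` as a `G_b`-module, Remark 2.5, `#B' = 4`) is irreducible — the
`Alt(B')`-module `(k^{B'})^0`, `#B' = 4`, `char(k) ≠ 2`, is irreducible (the tree's
`augmentationRep_isIrreducible_of_alternatingGroup_le` of `PicardCurveGaloisRep`).
[cite: Zarhin2002CyclicCovers, §2 Lemma 2.6] [cite: Zarhin2002CyclicCovers, §2 Remark 2.5]
[cite: Zarhin2023Superelliptic, §3 Lemma 3.3] -/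
theorem heart_isIrreducible_of_card_eq_five (h5 : Fintype.card X = 5) (hn : (Fintype.card X : k) = 0)
    (hA : alternatingGroup X ≤ (MulAction.toPermHom G X).range) : (heart k G X).IsIrreducible := by
  classical
  haveI : Nonempty X := Fintype.card_pos_iff.1 (by omega)
  obtain ⟨b⟩ := ‹Nonempty X›
  haveI : Fintype (SubMulAction.ofStabilizer G b) := Fintype.ofFinite _
  have hcard := card_ofStabilizer₃ (G := G) b
  have h2 : (2 : k) ≠ 0 := two_ne_zero_of_five_eq_zero k (by rw [h5] at hn; exact_mod_cast hn)
  haveI := augmentationRep_isIrreducible_of_alternatingGroup_le (k := k) (G := stabilizer G b)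
    (X := SubMulAction.ofStabilizer G b) h2 (by rw [hcard, h5])
    (alternatingGroup_le_range_stabilizer G X b hA)
  exact heart_isIrreducible_of_stabilizer k G b hn

/-- **Lemma 2.6 at `(n, p) = (5, 5)`, commutant**: under the same hypotheses `End_G((k^B)^{00}) = k·Id`
— `Alt(B')` is doubly transitive on the `4`-element set `B'`, so `End_{G_b}((k^{B'})^0) = k`
(g10-#3's `centralizer_augmentationRep_eq_bot_of_isMultiplyPretransitive`), transported by Remark 2.5.
[cite: Zarhin2002CyclicCovers, §2 Lemma 2.6] [cite: Zarhin2002CyclicCovers, §2 Remark 2.5] -/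
theorem centralizer_heart_eq_bot_of_card_eq_five (h5 : Fintype.card X = 5)
    (hn : (Fintype.card X : k) = 0) (hA : alternatingGroup X ≤ (MulAction.toPermHom G X).range) :
    Subalgebra.centralizer k
      (Set.range (heart k G X : G → Module.End k (augmentationSubmodule k X ⧸ heartKer k X))) = ⊥ := by
  classical
  haveI : Nonempty X := Fintype.card_pos_iff.1 (by omega)
  obtain ⟨b⟩ := ‹Nonempty X›
  haveI : Fintype (SubMulAction.ofStabilizer G b) := Fintype.ofFinite _
  have hcard := card_ofStabilizer₃ (G := G) b
  have h2 : (2 : k) ≠ 0 := two_ne_zero_of_five_eq_zero k (by rw [h5] at hn; exact_mod_cast hn)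
  -- `G_b` is doubly transitive on `B'` (it covers `Alt(B')`, `#B' = 4`)
  have hA' := alternatingGroup_le_range_stabilizer G X b hA
  haveI : IsMultiplyPretransitive (stabilizer G b) (SubMulAction.ofStabilizer G b) 2 := by
    have hA4 : IsMultiplyPretransitive (alternatingGroup (SubMulAction.ofStabilizer G b))
        (SubMulAction.ofStabilizer G b) 2 := by
      have := alternatingGroup.isMultiplyPretransitive (SubMulAction.ofStabilizer G b)
      rw [Nat.card_eq_fintype_card] at this
      haveI := this
      exact isMultiplyPretransitive_of_le (n := Fintype.card (SubMulAction.ofStabilizer G b) - 2)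
        (by rw [hcard, h5]) (by rw [Nat.card_eq_fintype_card]; omega)
    rw [is_two_pretransitive_iff] at hA4 ⊢
    intro a a' c c' haa' hcc'
    obtain ⟨σ, hσa, hσa'⟩ := hA4 haa' hcc'
    obtain ⟨g, hg⟩ := hA' σ.2
    refine ⟨g, ?_, ?_⟩
    · rw [← hσa, Subgroup.smul_def, Equiv.Perm.smul_def, ← hg, MulAction.toPermHom_apply,
        MulAction.toPerm_apply]
    · rw [← hσa', Subgroup.smul_def, Equiv.Perm.smul_def, ← hg, MulAction.toPermHom_apply,
        MulAction.toPerm_apply]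
  have h4 : (Fintype.card (SubMulAction.ofStabilizer G b) : k) ≠ 0 := by
    rw [hcard, h5]
    norm_num
    intro h4
    apply h2
    have : (4 : k) = 2 * 2 := by norm_num
    rw [this] at h4
    exact (mul_self_eq_zero.1 h4)
  exact centralizer_heart_eq_bot_of_stabilizer k G b hn
    (centralizer_augmentationRep_eq_bot_of_isMultiplyPretransitive (k := k) (G := stabilizer G b)
      (X := SubMulAction.ofStabilizer G b) (by rw [hcard, h5]; norm_num) h4)

/-- **The heart `(k^B)^{00}` is irreducible for every `n = #B ≥ 5`, every field `k` and every
`G ↠ ⊇ Alt(B)`** (Lemma 2.6 "the `G`-module `(𝔽_p^B)^{00}` is absolutely simple", now in all cases: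
`char(k) ∤ n` — Q1110 on `(k^B)^0`; `char(k) ∣ n`, `n ≥ 6` — g11-#1; `(n, p) = (5, 5)` — above).
[cite: Zarhin2002CyclicCovers, §2 Lemma 2.6] [cite: Zarhin2023Superelliptic, §3 Lemma 3.3] -/
theorem heart_isIrreducible_of_five_le (h5 : 5 ≤ Fintype.card X)
    (hA : alternatingGroup X ≤ (MulAction.toPermHom G X).range) : (heart k G X).IsIrreducible := by
  by_cases hn : (Fintype.card X : k) = 0
  · rcases Nat.lt_or_ge 5 (Fintype.card X) with h6 | hle
    · exact heart_isIrreducible_of_alternatingGroup_le k h6 hn hA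
    · exact heart_isIrreducible_of_card_eq_five k (le_antisymm hle h5) hn hA
  · haveI := augmentationRep_isIrreducible_of_alternatingGroup_le_of_five_le (k := k) h5 hn hA
    exact heart_isIrreducible_of_ne_zero k hn

/-- **`End_G((k^B)^{00}) = k·Id` for every `n ≥ 5`, every field `k` and every `G ↠ ⊇ Alt(B)`**
(Lemma 2.6, commutant half, all cases). [cite: Zarhin2002CyclicCovers, §2 Lemma 2.6]
[cite: Zarhin2023Superelliptic, §3 Lemma 3.3] -/
theorem centralizer_heart_eq_bot_of_five_le (h5 : 5 ≤ Fintype.card X)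
    (hA : alternatingGroup X ≤ (MulAction.toPermHom G X).range) :
    Subalgebra.centralizer k
      (Set.range (heart k G X : G → Module.End k (augmentationSubmodule k X ⧸ heartKer k X))) = ⊥ := by
  by_cases hn : (Fintype.card X : k) = 0
  · rcases Nat.lt_or_ge 5 (Fintype.card X) with h6 | hle
    · exact centralizer_heart_eq_bot_of_alternatingGroup_le k h6 hn hA
    · exact centralizer_heart_eq_bot_of_card_eq_five k (le_antisymm hle h5) hn hA
  · exact centralizer_eq_bot_of_equiv (heartEquivAugmentationRep k G X hn).symm
      (centralizer_augmentationRep_eq_bot h5 hn hA)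

end AbsolutelySimple

/-! ## §4 Theorem 4.7 (iv): the `Alt(B)`-module `(𝔽_p^B)^{00}` is central simple -/

section CentralSimple

variable (k : Type*) [Field k] {X : Type*} [Fintype X] [DecidableEq X]
variable {G : Type*} [Group G] [MulAction G X]

omit [DecidableEq X] in
/-- `dim (k^B)^{00} ∈ {n − 1, n − 2}`, so `(dim (k^B)^{00})! ≤ (n − 1)!`.
[cite: Zarhin2023Superelliptic, §4 Remark 4.8 (C) ("since `N ≤ n − 1`")] -/
theorem finrank_heart_le (h1 : 1 ≤ Fintype.card X) :
    finrank k (augmentationSubmodule k X ⧸ heartKer k X) ≤ Fintype.card X - 1 := by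
  haveI : Nonempty X := Fintype.card_pos_iff.1 h1
  by_cases hn : (Fintype.card X : k) = 0
  · rw [finrank_heart_of_eq_zero k X hn]
    omega
  · rw [finrank_heart_of_ne_zero k X hn]

/-- **Hypothesis (i) of Theorem 4.5 for `H = Alt(B)` on the heart** ("`Alt(B)` is a simple non-abelian
group of order `n!/2` and therefore its order is bigger that the order of `S_N`, since `N ≤ n − 1`",
Remark 4.8 (C)): `(dim (k^B)^{00})! < #Alt(B)` for `n ≥ 5` (indeed `n ≥ 3`).
[cite: Zarhin2023Superelliptic, §4 Remark 4.8 (C)] -/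
theorem factorial_finrank_heart_lt_card_alternatingGroup (h3 : 3 ≤ Fintype.card X) :
    (finrank k (augmentationSubmodule k X ⧸ heartKer k X)).factorial < Nat.card (alternatingGroup X) := by
  have hA2 : 2 * Nat.card (alternatingGroup X) = (Fintype.card X).factorial := by
    haveI : Nontrivial X := Fintype.one_lt_card_iff_nontrivial.1 (by omega)
    rw [two_mul_nat_card_alternatingGroup, Nat.card_perm, Nat.card_eq_fintype_card]
  have h1 := Nat.factorial_le (finrank_heart_le k (X := X) (by omega))
  have h2 := two_mul_factorial_pred_lt (n := Fintype.card X) h3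
  omega

/-- **Theorem 4.7 (iv) (Zarhin 2023): "The `Alt(B)`-module `(𝔽_p^B)^{00}` is central simple"** — for
every `n = #B ≥ 5` and every FINITE field `k` (the print: `k = 𝔽_p`, any prime `p`). Proof: Theorem 4.5
(e) for `H = G = Alt(B)` (FILE 1's `isCentralSimple_of_factorial_lt`): `Alt(B)` is simple, the heart is
absolutely simple (§3, all `(n, p)`), and (i) holds because `N! ≤ (n − 1)! < n!/2 = #Alt(B)`. The
print derives (iv) from (ii) and (iii), i.e. through the very-simplicity results and, for `n = 5`,
`p ≡ ±1 (mod 5)`, through (iii); the route here is uniform in `(n, p)` and is the one the print uses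
for Theorem 4.9 (Proposition 4.4 / Theorem 4.5 (e)). [cite: Zarhin2023Superelliptic, §4 Theorem 4.7 (iv)]
[cite: Zarhin2023Superelliptic, §4 Theorem 4.5 (e)] -/
theorem isCentralSimple_heart_alternatingGroup [Finite k] (h5 : 5 ≤ Fintype.card X) :
    IsCentralSimple (heart k (alternatingGroup X) X) := by
  have hcard : 5 ≤ Nat.card X := by rwa [Nat.card_eq_fintype_card]
  haveI : IsSimpleGroup (alternatingGroup X) := alternatingGroup.isSimpleGroup hcard
  haveI := heart_isIrreducible_of_five_le k (G := alternatingGroup X) h5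
    alternatingGroup_le_range_toPermHom_self₃
  exact isCentralSimple_of_factorial_lt
    (centralizer_heart_eq_bot_of_five_le k h5 alternatingGroup_le_range_toPermHom_self₃)
    (factorial_finrank_heart_lt_card_alternatingGroup k (by omega))

/-- **Theorem 4.7 (iv) for every `G` whose image in `Perm(B)` contains `Alt(B)`** (Remark 4.2 (ii),
(iv): central simplicity for the operators `ρ(Alt(B)) ⊂ ρ(G)` suffices), `k` finite, `n ≥ 5`.
[cite: Zarhin2023Superelliptic, §4 Theorem 4.7 (iv)] [cite: Zarhin2023Superelliptic, §4 Remark 4.2 (iv)] -/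
theorem isCentralSimple_heart_of_alternatingGroup_le [Finite k] (h5 : 5 ≤ Fintype.card X)
    (hA : alternatingGroup X ≤ (MulAction.toPermHom G X).range) : IsCentralSimple (heart k G X) :=
  (isCentralSimple_heart_alternatingGroup k h5).of_range_subset (range_heart_alternatingGroup_subset k hA)

/-- **Theorem 4.7 (iv) for `Perm(B)`**: the `Perm(B)`-module `(k^B)^{00}` is central simple, `k`
finite, `n ≥ 5`. [cite: Zarhin2023Superelliptic, §4 Theorem 4.7 (iv)] -/
theorem isCentralSimple_heart_perm [Finite k] (h5 : 5 ≤ Fintype.card X) :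
    IsCentralSimple (heart k (Equiv.Perm X) X) :=
  isCentralSimple_heart_of_alternatingGroup_le k h5 fun σ _ ↦ ⟨σ, Equiv.ext fun _ ↦ rfl⟩

/-- **Theorem 4.7 (iv) verbatim, `k = 𝔽_p`**: for every prime `p` and every `n = #B ≥ 5` the
`Alt(B)`-module `(𝔽_p^B)^{00}` is central simple. [cite: Zarhin2023Superelliptic, §4 Theorem 4.7 (iv)] -/
theorem isCentralSimple_heart_alternatingGroup_zmod {p : ℕ} [Fact p.Prime] (h5 : 5 ≤ Fintype.card X) :
    IsCentralSimple (heart (ZMod p) (alternatingGroup X) X) :=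
  isCentralSimple_heart_alternatingGroup (ZMod p) h5

/-- The `Alt(B)`-module `(k^B)^{00}` is strongly simple (Remark 4.2 (i)), `k` finite, `n ≥ 5`.
[cite: Zarhin2023Superelliptic, §4 Theorem 4.7 (iv) and Remark 4.2 (i)] -/
theorem isStronglySimple_heart_alternatingGroup [Finite k] (h5 : 5 ≤ Fintype.card X) :
    IsStronglySimple (heart k (alternatingGroup X) X) :=
  (isCentralSimple_heart_alternatingGroup k h5).isStronglySimple

end CentralSimple

/-! ## §5 Theorem 4.7 (iii): `n = 5` — a normal subalgebra is `𝔽_p·Id`, `End`, or `≅ Mat_2(𝔽_p)` -/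

section CardFive

variable (k : Type*) [Field k] {X : Type*} [Fintype X] [DecidableEq X]
variable {G : Type*} [Group G] [MulAction G X]

/-- **Theorem 4.7 (iii) (Zarhin 2023).** "Suppose that `n = 5`, `p ≡ ±1 mod 5` and
`R ⊂ End_{𝔽_p}((𝔽_p^B)^{00})` is a `Alt(B)`-normal subalgebra. Then either `R = 𝔽_p · Id`, or
`R = End_{𝔽_p}((𝔽_p^B)^{00})`, or the `𝔽_p`-algebra `R` is isomorphic to the matrix algebra `Mat_2(𝔽_p)`
of size `2` over `𝔽_p`." Proved for EVERY finite field `k` and every `G ↠ ⊇ Alt(B)` with `#B = 5` (the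
printed congruence is where the third case actually occurs — Step 5 of the printed proof, the
`SL(2, 𝔽_5)`-tensor decomposition, not formalised here): by Theorem 4.5 (b) for the operators of
`Alt(B)` (FILE 1's `exists_algEquiv_matrix_of_forall_index_dvd`, (i) by the order count
`N! ≤ 4! < 60`), `R ≅ Mat_a(k)` with `a ∣ N = dim (k^B)^{00} ∈ {3, 4}`; `a = 1` iff
`R = k·Id`, `a = N` iff `R = End`, and otherwise `a = 2`. [cite: Zarhin2023Superelliptic, §4 Theorem 4.7 (iii)]
[cite: Zarhin2023Superelliptic, §4 Theorem 4.5 (b)] -/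
theorem eq_bot_or_eq_top_or_nonempty_algEquiv_matrix_two_of_card_eq_five [Finite k]
    (h5 : Fintype.card X = 5) (hA : alternatingGroup X ≤ (MulAction.toPermHom G X).range)
    {R : Subalgebra k (Module.End k (augmentationSubmodule k X ⧸ heartKer k X))}
    (hR : IsNormalSubalgebra (heart k G X) R) :
    R = ⊥ ∨ R = ⊤ ∨ Nonempty (R ≃ₐ[k] Matrix (Fin 2) (Fin 2) k) := by
  have hcard : 5 ≤ Nat.card X := by rw [Nat.card_eq_fintype_card, h5]
  haveI : IsSimpleGroup (alternatingGroup X) := alternatingGroup.isSimpleGroup hcard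
  -- work with the operators of `Alt(B)`, for which (i) holds by the order count
  have hR' : IsNormalSubalgebra (heart k (alternatingGroup X) X) R :=
    hR.of_range_subset (range_heart_alternatingGroup_subset k hA)
  haveI := heart_isIrreducible_of_five_le k (G := alternatingGroup X) (by omega)
    alternatingGroup_le_range_toPermHom_self₃
  haveI : Nontrivial (augmentationSubmodule k X ⧸ heartKer k X) :=
    IsSimpleOrder.bot_ne_top (α := Subrepresentation (heart k (alternatingGroup X) X)) |> fun hne ↦
      (Submodule.nontrivial_iff k).mp (nontrivial_of_ne _ _ fun e ↦
        hne (Subrepresentation.toSubmodule_injective e))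
  obtain ⟨a, b, ha, hb, hN, ⟨Ψ⟩, -⟩ := hR'.exists_algEquiv_matrix_of_forall_index_dvd
    (end_comm_of_finite R) (centralizer_heart_eq_bot_of_five_le k (by omega)
      alternatingGroup_le_range_toPermHom_self₃)
    (forall_index_dvd_imp_eq_top_of_factorial_lt
      (factorial_finrank_heart_lt_card_alternatingGroup k (by omega)) finrank_pos.ne')
  have hNle : finrank k (augmentationSubmodule k X ⧸ heartKer k X) ≤ 4 := by
    have := finrank_heart_le k (X := X) (by omega)
    omega
  -- `a ∣ N ≤ 4`: `a = 1` (`R = k·Id`), `a = N` (`R = End`), or `a = 2`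
  by_cases ha1 : a = 1
  · exact Or.inl ((subalgebra_eq_bot_iff_of_algEquiv_matrix Ψ).2 ha1)
  by_cases hb1 : b = 1
  · exact Or.inr (Or.inl ((subalgebra_eq_top_iff_of_algEquiv_matrix ha hN Ψ).2 hb1))
  right; right
  have ha2 : a = 2 := by
    have h2a : 2 ≤ a := by omega
    have h2b : 2 ≤ b := by omega
    have hab : a * b ≤ 4 := hN ▸ hNle
    nlinarith
  subst ha2
  exact ⟨Ψ⟩

/-- **Theorem 4.7 (iii) verbatim** (`k = 𝔽_p`, `G = Alt(B)`, `#B = 5`, any prime `p`).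
[cite: Zarhin2023Superelliptic, §4 Theorem 4.7 (iii)] -/
theorem zarhin2023_theorem_4_7_iii {p : ℕ} [Fact p.Prime] (h5 : Fintype.card X = 5)
    {R : Subalgebra (ZMod p) (Module.End (ZMod p) (augmentationSubmodule (ZMod p) X ⧸ heartKer (ZMod p) X))}
    (hR : IsNormalSubalgebra (heart (ZMod p) (alternatingGroup X) X) R) :
    R = ⊥ ∨ R = ⊤ ∨ Nonempty (R ≃ₐ[ZMod p] Matrix (Fin 2) (Fin 2) (ZMod p)) :=
  eq_bot_or_eq_top_or_nonempty_algEquiv_matrix_two_of_card_eq_five (ZMod p) h5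
    alternatingGroup_le_range_toPermHom_self₃ hR

end CardFive

end Literature.RepresentationTheory
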